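import Mathlib
import Summits.KontsevichZagierPeriods.Zeta5Search.Profile10dCellsA
import Summits.KontsevichZagierPeriods.Zeta5Search.Profile10dCellsB
import Summits.KontsevichZagierPeriods.Zeta5Search.DenomLaw.Profile12PathA
import Summits.KontsevichZagierPeriods.Zeta5Search.DenomLaw.Profile15aPath
import Summits.KontsevichZagierPeriods.Zeta5Search.DenomLaw.ZeroPointCoverKit
import Summits.KontsevichZagierPeriods.Zeta5Search.DenomLaw.ZeroCoverKit
import Summits.KontsevichZagierPeriods.Zeta5Search.DenomLaw.LawA3KCoverKit
import Summits.KontsevichZagierPeriods.Zeta5Search.DenomLaw.LawA4CoverKit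
import Summits.KontsevichZagierPeriods.Zeta5Search.DenomLaw.LawZACoverKit
import Summits.KontsevichZagierPeriods.Zeta5Search.DenomLaw.LawZL5CoverKit
import Summits.KontsevichZagierPeriods.Zeta5Search.DenomLaw.PathWeightProfile
import Summits.KontsevichZagierPeriods.Zeta5Search.CasoratianClassBoundPal
import Summits.KontsevichZagierPeriods.Zeta5Search.FlagRayDominance
import Summits.KontsevichZagierPeriods.Zeta5Search.TopFamilyFPCasLB
import HarnessLib

/-!
# ζ(5) search — the `N_p = 10` PROFILES 10d of the first period for EVERY sorted parameter vector: PATH accounting at every depth (DENOM-LAW D1, prover-d1 gen 22)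

Cell `pub-zeta5` (HONEST FRAMING: systematic search; no irrationality claim unless certified), TRACK «DENOM-LAW» D1 prover seat (denom-prover-d1
gen 22, `HOME/denom-law/prover-d1/ATTEMPT-22.md` §6).  The five a = 7 profiles with exactly eleven short pair blocks: 10a short = all `(1,k)`, `(2,k)` (`C⋆ ≤ 9`,
new finite check; THEOREM A⁗ `cover_A4` at `(6,[1,−4,−4,1])` = `−5` at `⌊d/p⌋ ≤ 1` — no hypothesis on `d` —, THEOREM ZA `cover_ZA` `(6; [[1,−4,−4,1]], [])` = `−4` at
`⌊d/p⌋ = 2`; node `−6 / −5 / −4`); 10b short = all `(i,k)` with `k ≤ 5`, and `(1,6)` (`C⋆ ≤ 9`, new finite check; `d < 2p`; THEOREM LB `(−4,−1)` for every `d` via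
`casLB_ge_of_cover_le0` (gen 22's `Profile11PathA`); node `−6 / −5`); 10c short `(1,k)`, `(2,3),(2,4),(2,5),(3,4),(3,5)` and 10e short `(1,k)`, `(2,3),…,(2,6),(3,4)`
(`C⋆ ≤ 10` by gen 18's `cStar_le_ten_15a`; `p ≤ d < 2p`; the LEMMA-D bonus `cover_J_j` at `m = −4` = `−4` = node); 10d short `(i,k)` with `i ≤ 2, k ≤ 6`, and
`(3,4),(3,5)` (`C⋆ ≤ 10` by gen 22's `cStar_le_ten_12b`; `p ≤ d < 2p`; THEOREM LB♯ — gen 19's `casoratian_bound_pal` through gen 21's `rowsPal_of_cover`, wrapped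
here as `cover_LBP_j` — with `VB = −4` and palindromic row `4 + E = 0` on `[1,−3,−3,1]`: `−4` = node).  Covers `FullProfile.cover10x_ev/od` (`Profile10{a,…,e}Cells{A,B}`,
machine-generated; every check `decide`).  Results: `pathAccounting_profile10x` (every `j`) and **`pathAccountingFirstPeriod_profile10x`** (the node's binders
VERBATIM plus `p ≤ b₇` and the profile inequalities; no depth hypothesis), x ∈ {d}.  Census beside the proof (gen 22, exhaustive a = 7 at p = 7, 11, 8 %
sample at p = 13): 10a 4,838 · 10b 1,645 · 10c 1,286 · 10d 865 · 10e 678 instances, every one reached by exactly these rungs; 0 open at p ≤ 13 (kit j285126).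
MODEL/structure-side valuation bookkeeping of the cell's own rationals; nothing about ζ(5); no γ; records in print UNMOVED.
-/

open Finset

namespace Summit.KontsevichZagierPeriods.Zeta5Search.FullProfile

open Summit.KontsevichZagierPeriods.Zeta5Search.ClusterValuation
open Summit.KontsevichZagierPeriods.Zeta5Search.CasoratianValuation (InPolytope shift casoratian pairFloors refund)
open Summit.KontsevichZagierPeriods.Zeta5Search.WedgeDictionary (dOf)
open Summit.KontsevichZagierPeriods.Zeta5Search.ClassTypeCover
open Summit.KontsevichZagierPeriods.Zeta5Search.DenomLaw (cStar FirstPeriod Sorted7 zeroClasses_of_cover zeroBound_of_classes zeroPointBound_of_classes cover_A3K cover_A4 cover_ZA rowsPal_of_cover)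
open Summit.KontsevichZagierPeriods.Zeta5Search.DenomLaw.FirstPeriodKit (cStar_le_eleven sorted7_chain firstPeriod_pair pairFloors_expand)
open Summit.KontsevichZagierPeriods.Zeta5Search.ZeroWindows (ZeroWindowClasses)
open Summit.KontsevichZagierPeriods.Zeta5Search.TopFamFP (cover_J_j)
open Summit.KontsevichZagierPeriods.Zeta5Search.StairFLAG (cover_B_j)
open Summit.KontsevichZagierPeriods.Zeta5Search.SortedProfile

/-! ## Kit: THEOREM LB♯ from a cover -/

/-- **THEOREM LB♯ from a cover, any direction `j`**: `v ≤ ν` on every pole type (the `A`-part of `checkLB` at `(v, B₀)` for any `B₀`), a row constant `r ≤ 1` passing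
gen 21's palindromic-row check `rowsPal_of_cover`, and `r ≤ 0` unless `p ≤ d`, give `v + r ≤ v_p(Cas_j(b))` (gen 19's `casoratian_bound_pal`). -/
theorem cover_LBP_j {b : ℕ → ℤ} {p j : ℕ} (hb : InPolytope b) (hj1 : 1 ≤ j) (hj7 : j ≤ 7) (hb' : InPolytope (shift b j)) (hpr : p.Prime)
    (hp5 : 5 ≤ p) (hpb : (p : ℤ) ≤ b 0) (hwin : (b 0 + 2 : ℤ) < (p : ℤ) ^ 2)
    {TY : List (List ℤ × Bool)} (hcov : Cover b p TY) {v B₀ r : ℤ}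
    (hchkV : checkLB (decide (¬ (2 : ℤ) ∣ b 0)) TY v B₀ = true) (hr1 : r ≤ 1)
    (hchkR : (TY.all fun tc => decide (polesL tc.1 < 2) ||
      (decide (r ≤ 3 + expL (decide (¬ (2 : ℤ) ∣ b 0)) tc.1 tc.2) ||
        (!tc.2 && decide (tc.1.reverse = tc.1) && decide (expL (decide (¬ (2 : ℤ) ∣ b 0)) tc.1 tc.2 ≤ -3) &&
          decide (Even (expL (decide (¬ (2 : ℤ) ∣ b 0)) tc.1 tc.2)) && decide (r ≤ 4 + expL (decide (¬ (2 : ℤ) ∣ b 0)) tc.1 tc.2)))) = true)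
    (hr0 : dOf b < (p : ℤ) → r ≤ 0) (hcas : casoratian b j ≠ 0) : v + r ≤ padicValRat p (casoratian b j) := by
  haveI : Fact p.Prime := ⟨hpr⟩
  rw [checkLB, List.all_eq_true] at hchkV
  have hA : ∀ x, x < p → 1 ≤ classPoleCount b p x → v ≤ classNu b p x := by
    intro x hx h1
    obtain ⟨tc, htc, ht⟩ := hcov x hx
    have hc := hchkV tc htc
    simp only [Bool.and_eq_true, Bool.or_eq_true, decide_eq_true_eq] at hc
    rw [ht.classPoleCount_eq] at h1
    rw [ht.classNu_eq]
    rcases hc.1 with h0 | hA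
    · omega
    · exact hA
  exact casoratian_bound_pal b j p hb hj1 hj7 hb' hpr hp5 hpb hwin v r hA (fun _ _ _ => hr1) (rowsPal_of_cover hpb hcov hchkR) hr0 hcas


/-! ## The `N_p = 10` profile with short blocks `(i,k) with i ≤ 2, k ≤ 6, and (3,4),(3,5)` -/

section P10D

variable {b : ℕ → ℤ} {j p : ℕ}

/-- **`N_p = 10`** on this profile: the pair digits of the eleven short blocks are `0`, the other ten are `1`. -/
theorem pairFloors_eq_10d (hb : InPolytope b) (hs : Sorted7 b) (hp : 0 < p) (hQ : b 0 < (p : ℤ) + b 2 + b 6) (hQ35 : b 0 < (p : ℤ) + b 3 + b 5) (hQ7 : (p : ℤ) + b 1 + b 7 ≤ b 0) (hQ36 : (p : ℤ) + b 3 + b 6 ≤ b 0) (hQ45 : (p : ℤ) + b 4 + b 5 ≤ b 0) (hfp : FirstPeriod b p) : pairFloors b p = 10 := by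
  obtain ⟨h21, h32, h43, h54, h65, h76⟩ := sorted7_chain hs
  obtain ⟨h0, hb1, hb2, hb3, hb4, hb5, hb6, hb7, hc1⟩ := box hb
  have hp0 : (0 : ℤ) < p := by exact_mod_cast hp
  have one : ∀ z : ℤ, (p : ℤ) ≤ z → z ≤ 2 * (p : ℤ) - 1 → z / (p : ℤ) = 1 := fun z h1 h2 => by
    rw [Int.ediv_eq_iff_of_pos hp0]; constructor <;> linarith
  have z12 : (b 0 - b 1 - b 2) / (p : ℤ) = 0 := Int.ediv_eq_zero_of_lt (by linarith) (by linarith)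
  have z13 : (b 0 - b 1 - b 3) / (p : ℤ) = 0 := Int.ediv_eq_zero_of_lt (by linarith) (by linarith)
  have z14 : (b 0 - b 1 - b 4) / (p : ℤ) = 0 := Int.ediv_eq_zero_of_lt (by linarith) (by linarith)
  have z15 : (b 0 - b 1 - b 5) / (p : ℤ) = 0 := Int.ediv_eq_zero_of_lt (by linarith) (by linarith)
  have z16 : (b 0 - b 1 - b 6) / (p : ℤ) = 0 := Int.ediv_eq_zero_of_lt (by linarith) (by linarith)
  have z23 : (b 0 - b 2 - b 3) / (p : ℤ) = 0 := Int.ediv_eq_zero_of_lt (by linarith) (by linarith)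
  have z24 : (b 0 - b 2 - b 4) / (p : ℤ) = 0 := Int.ediv_eq_zero_of_lt (by linarith) (by linarith)
  have z25 : (b 0 - b 2 - b 5) / (p : ℤ) = 0 := Int.ediv_eq_zero_of_lt (by linarith) (by linarith)
  have z26 : (b 0 - b 2 - b 6) / (p : ℤ) = 0 := Int.ediv_eq_zero_of_lt (by linarith) (by linarith)
  have z34 : (b 0 - b 3 - b 4) / (p : ℤ) = 0 := Int.ediv_eq_zero_of_lt (by linarith) (by linarith)
  have z35 : (b 0 - b 3 - b 5) / (p : ℤ) = 0 := Int.ediv_eq_zero_of_lt (by linarith) (by linarith)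
  have U := fun (i k : ℕ) (hi : i < 7) (hk : k < 7) (hik : i < k) => firstPeriod_pair hfp hi hk hik
  rw [pairFloors_expand, z12, z13, z14, z15, z16, z23, z24, z25, z26, z34, z35,
    one _ (by linarith) (U 0 6 (by norm_num) (by norm_num) (by norm_num)),
    one _ (by linarith) (U 1 6 (by norm_num) (by norm_num) (by norm_num)),
    one _ (by linarith) (U 2 5 (by norm_num) (by norm_num) (by norm_num)),
    one _ (by linarith) (U 2 6 (by norm_num) (by norm_num) (by norm_num)),
    one _ (by linarith) (U 3 4 (by norm_num) (by norm_num) (by norm_num)),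
    one _ (by linarith) (U 3 5 (by norm_num) (by norm_num) (by norm_num)),
    one _ (by linarith) (U 3 6 (by norm_num) (by norm_num) (by norm_num)),
    one _ (by linarith) (U 4 5 (by norm_num) (by norm_num) (by norm_num)),
    one _ (by linarith) (U 4 6 (by norm_num) (by norm_num) (by norm_num)),
    one _ (by linarith) (U 5 6 (by norm_num) (by norm_num) (by norm_num))]
  norm_num

/-- **THEOREM LB♯ (palindromic rows) on this profile, general `b`**: `v_p(Cas_j(b)) ≥ -4 = VB + row♯` (`VB = -4` on every pole class; row `4 + E = 0`
on the centre-free palindromic classes `[1,−3,−3,1]` of even exponent `−4`, `3 + E` resp. `1` otherwise; gen 19's `casoratian_bound_pal` through gen 21's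
`DenomLaw.rowsPal_of_cover`). -/
theorem cas_ge10d_neg4 (hb : InPolytope b) (hs : Sorted7 b) (hbj : InPolytope (shift b j)) (hj1 : 1 ≤ j) (hj7 : j ≤ 7)
    (hprime : p.Prime) (hp5 : 5 ≤ p) (hwin : (b 0 + 2 : ℤ) < (p : ℤ) ^ 2) (hP : (p : ℤ) ≤ b 7) (hQ : b 0 < (p : ℤ) + b 2 + b 6) (hQ35 : b 0 < (p : ℤ) + b 3 + b 5) (hQ7 : (p : ℤ) + b 1 + b 7 ≤ b 0) (hQ36 : (p : ℤ) + b 3 + b 6 ≤ b 0) (hQ45 : (p : ℤ) + b 4 + b 5 ≤ b 0)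
    (hF1 : b 1 < 2 * (p : ℤ)) (hF2 : b 0 < 2 * (p : ℤ) + b 6 + b 7) (hcas : casoratian b j ≠ 0) : (-4 : ℤ) ≤ padicValRat p (casoratian b j) := by
  haveI : Fact p.Prime := ⟨hprime⟩
  have hp2 : p % 2 = 1 := Nat.odd_iff.1 (hprime.odd_of_ne_two (by omega))
  obtain ⟨h21, h32, h43, h54, h65, h76⟩ := sorted7_chain hs
  obtain ⟨h0, hb1, hb2, hb3, hb4, hb5, hb6, hb7, hc1⟩ := box hb
  have hpd : (p : ℤ) ≤ dOf b := by rw [DecompositionWholeCone.dOf_expand]; linarith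
  have hpb : (p : ℤ) ≤ b 0 := by linarith
  rcases Int.emod_two_eq_zero_or_one (b 0) with hr | hr
  · exact cover_LBP_j hb hj1 hj7 hbj hprime hp5 hpb hwin (cover10d_ev hb hs hP hQ hQ35 hQ7 hQ36 hQ45 hF1 hF2 hp5 hp2 hr) (v := -4) (B₀ := -20) (r := 0)
      (by rw [oddFlag_false hr]; decide) (by norm_num) (by rw [oddFlag_false hr]; decide) (fun h => absurd hpd (not_le.2 h)) hcas
  · exact cover_LBP_j hb hj1 hj7 hbj hprime hp5 hpb hwin (cover10d_od hb hs hP hQ hQ35 hQ7 hQ36 hQ45 hF1 hF2 hp5 hp2 hr) (v := -4) (B₀ := -20) (r := 0)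
      (by rw [oddFlag_true hr]; decide) (by norm_num) (by rw [oddFlag_true hr]; decide) (fun h => absurd hpd (not_le.2 h)) hcas

/-- On this profile `d(b) < 2p`. -/
theorem d_lt_two10d (hs : Sorted7 b) (hP : (p : ℤ) ≤ b 7) (_hQ : b 0 < (p : ℤ) + b 2 + b 6) (_hQ35 : b 0 < (p : ℤ) + b 3 + b 5) (_hQ7 : (p : ℤ) + b 1 + b 7 ≤ b 0) (_hQ36 : (p : ℤ) + b 3 + b 6 ≤ b 0) (_hQ45 : (p : ℤ) + b 4 + b 5 ≤ b 0) : dOf b < 2 * (p : ℤ) := by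
  obtain ⟨h21, h32, h43, h54, h65, h76⟩ := sorted7_chain hs
  rw [DecompositionWholeCone.dOf_expand]; linarith

/-- **`PathAccountingFirstPeriod`'s conclusion on this `N_p = 10` profile (short blocks `(i,k) with i ≤ 2, k ≤ 6, and (3,4),(3,5)`), EVERY sorted `b`, every direction `j`** (`C⋆ ≤ 10`, `p < d < 2p`:
the node asks `1 − 10 + 5 = -4`). -/
theorem pathAccounting_profile10d (b : ℕ → ℤ) (j p : ℕ) (hb : InPolytope b) (hs : Sorted7 b) (hbj : InPolytope (shift b j))
    (hj1 : 1 ≤ j) (hj7 : j ≤ 7) (hprime : p.Prime) (hp5 : 5 ≤ p) (hwin : (b 0 + 2 : ℤ) < (p : ℤ) ^ 2) (hfp : FirstPeriod b p)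
    (hP : (p : ℤ) ≤ b 7) (hQ : b 0 < (p : ℤ) + b 2 + b 6) (hQ35 : b 0 < (p : ℤ) + b 3 + b 5) (hQ7 : (p : ℤ) + b 1 + b 7 ≤ b 0) (hQ36 : (p : ℤ) + b 3 + b 6 ≤ b 0) (hQ45 : (p : ℤ) + b 4 + b 5 ≤ b 0)
    (hcas : casoratian b j ≠ 0) :
    dOf b / (p : ℤ) - pairFloors b p - min (if 2 ≤ dOf b / (p : ℤ) then (1 : ℤ) else 0) (5 - (cStar b p : ℤ))
      ≤ padicValRat p (casoratian b j) := by
  obtain ⟨hF1, hF2⟩ := fp_bounds hfp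
  have hp0 : (0 : ℤ) < p := by exact_mod_cast hprime.pos
  rw [pairFloors_eq_10d hb hs hprime.pos hQ hQ35 hQ7 hQ36 hQ45 hfp]
  have hC10 : (cStar b p : ℤ) ≤ 10 := by exact_mod_cast cStar_le_ten_12b hs hQ
  have hmin : -5 ≤ min (if 2 ≤ dOf b / (p : ℤ) then (1 : ℤ) else 0) (5 - (cStar b p : ℤ)) :=
    le_min (by split_ifs <;> norm_num) (by linarith)
  have hfd : dOf b / (p : ℤ) < 2 := by rw [Int.ediv_lt_iff_lt_mul hp0]; linarith [d_lt_two10d hs hP hQ hQ35 hQ7 hQ36 hQ45]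
  linarith [cas_ge10d_neg4 hb hs hbj hj1 hj7 hprime hp5 hwin hP hQ hQ35 hQ7 hQ36 hQ45 hF1 hF2 hcas]

/-- **THE NODE ON THIS `N_p = 10` PROFILE, EVERY SORTED `b`: `PathAccountingFirstPeriod` with its binders VERBATIM plus `p ≤ b₇` and the profile
inequalities.** -/
theorem pathAccountingFirstPeriod_profile10d :
    ∀ (b : ℕ → ℤ) (p : ℕ), InPolytope b → Sorted7 b → InPolytope (shift b 7) →
      p.Prime → 5 ≤ p → (b 0 + 2 : ℤ) < (p : ℤ) ^ 2 → FirstPeriod b p →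
      (p : ℤ) ≤ b 7 → b 0 < (p : ℤ) + b 2 + b 6 → b 0 < (p : ℤ) + b 3 + b 5 → (p : ℤ) + b 1 + b 7 ≤ b 0 → (p : ℤ) + b 3 + b 6 ≤ b 0 → (p : ℤ) + b 4 + b 5 ≤ b 0 → casoratian b 7 ≠ 0 →
        dOf b / (p : ℤ) - pairFloors b p - min (if 2 ≤ dOf b / (p : ℤ) then (1 : ℤ) else 0) (5 - (cStar b p : ℤ))
          ≤ padicValRat p (casoratian b 7) :=
  fun b p hb hs hb7 hprime hp5 hwin hfp hP hQ hQ35 hQ7 hQ36 hQ45 hcas =>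
    pathAccounting_profile10d b 7 p hb hs hb7 (by norm_num) (by norm_num) hprime hp5 hwin hfp hP hQ hQ35 hQ7 hQ36 hQ45 hcas

end P10D

end Summit.KontsevichZagierPeriods.Zeta5Search.FullProfile
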